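import Summits.QuantumFields.YangMills.Theorems.PoincareLipschitzLogCutoffStabilityCap
import Summits.QuantumFields.YangMills.Theorems.PoincareLipschitzEuclideanTwistDictionary
import HarnessLib

/-!
# Crux `HistoryTailL` (stmt-QuantumFields-19936), K2 organ of record `hImproveCore` (LEAD ★w1-19936 g9, FROZEN v1 7446c95a; ✓K-4 p709961
# `hImprove ⟸ hImproveCore`, ✓K-5 p709591 `hImproveCore ⟸ hImproveCoreFlat`):
# ★★★ THE ORGAN'S `∀Λ₀` IS REMOVABLE — `hImproveCore∣_{Λ₀ := c} ⟹ hImproveCore` FOR EVERY `c > 18` (the large-energy half of the K2 residue is a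
# tree theorem on `ℤ³`; what remains is the parameter-free «`φ ≤ 19` ⇒ `φ ≤ ε₁` at a comparable scale», i.e. the gap ∕ compactness half)

Cell `ym3-torus` (YM ladder rung R3 = continuum SU(2) Yang–Mills on the three-torus — a RUNG, NOT the Clay problem: not d = 4, not infinite
volume, not a mass gap), WIDTH seat `ym-ust-19936-w3` gen 14; `--supports stmt-QuantumFields-19936 --as helper`; THEOREMS ONLY, definition-free.
Imports ✓∕⧗`…LogCutoffStabilityCap` (★★★`exists_scale_energy_le`: one good scale per window from twisted Leung–Xin minimality) and ✓∕⧗`…EuclideanTwistDictionary`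
(§1 of the road: `E⁴ ↔ Fin 4 → ℝ`, standard matrix of a twist) + HarnessLib.

WHY.  The display of record v2∕v3 reads `HistoryTailL ⟸ {K1-exp, hImprove ⟸ hImproveCore ⟸ hImproveCoreFlat, MeanDeviationL}`; the organ
`hImproveCore` («bounded normalised twisted energy `≤ Λ₀` ⟹ `≤ ε₁` at ONE comparable scale», every `Λ₀`) is Schoen–Uhlenbeck's `d(3) = 3`
regularity on the lattice.  Its «bounded ⇒ capped» half is the log-cutoff stability test, which ✓`exists_scale_energy_le` proves on `ℤ³` in the
stability letters (`Fin 4 → ℝ`, orthogonal bond twists `S_b`).  THIS FILE is the bridge to the organ's own letters and the consequence: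
(§1 = ✓∕⧗`…EuclideanTwistDictionary`: standard matrix `M` of a twist, `S := Mᵀ` orthogonal, Frobenius defect `≤ 4τ₀²`); (§2) the organ's LOCAL-MINIMALITY ROW (unit competitors agreeing with
`u` off `Q_{R−1}(z)`) applied to the Leung–Xin competitor `x ↦ toLp (U_t^{a,η}(x))` (unit by ✓`varied_dot_self`, `= u` where `η = 0`) gives
✓`exists_scale_energy_le`'s minimality hypothesis on `T = Q_R(z) × Fin 3` for every cutoff supported in `Q_{2M}(z)`, `2M ≤ R − 1`
(★★`sum_corr_varied_le_of_localMin`); (§3) ★★★`hImproveCore_of_capped`: with `c′ = (c+18)∕2`, `r = ⌊(R−5)∕(2C₁(c′))⌋`, `M = ⌈C₁r⌉`, twists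
`Σ‖S_b − 1‖_F² ≤ 12(2R+1)³τ₀² ≤ r` (from `τ₀R ≤ C₀⁻¹`, `C₀ ≥ 1296C₁`), the cap yields `k ∈ [r, M)` with `E_τ(Q_{k−1}) ≤ c′k ≤ c(k−1)`; the
capped organ at the top scale `k − 1` returns the good scale `r′`, and `R ≤ (8C₁+10)C₀′·r′`.  CONSEQUENCE FOR THE DISPLAY (LEAD ∕ OWNER WORD 13
decide; recorded, not claimed): since ✓K-5 gives `Flat ⟹ Core ⟹ Core∣₁₉` trivially and this file gives `Core∣₁₉ ⟹ Core`, the K2 organ may be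
displayed as the PARAMETER-FREE `hImproveCore∣_{Λ₀ := 19}` — logically weaker-or-equal to `hImproveCoreFlat` v1, at the price of keeping the twist
letters (the Flat text's slack row `δ(ρ+1)` admits no second-variation argument — located ★w3 g14 08:36:48Z).

WHAT (ns `…Theorems.PoincareLipschitzImproveCoreOfCapped`).
* §2 ★★`sum_corr_varied_le_of_localMin`, `energy_box_eq_sum_dot`.
* §3 ★★`exists_scale_energy_le_organ` (one good scale per window, organ letters; default heartbeats, 100k-clean).
* §4 ★★★`hImproveCore_of_capped (hc : 18 < c) (hCap : ⟨hImproveCore v1 with `∀Λ₀` deleted, `Λ₀ * R ↦ c * R`⟩) : ⟨hImproveCore v1 7446c95a VERBATIM⟩`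
  (decl-local `maxHeartbeats 400000`, RULING №24 (d): fails at 100k — the `Nat.floor`∕`Nat.ceil` real arithmetic).
HONEST SCOPE.  A reduction between two displayed texts + the dictionary; `hImproveCore` ∕ `hImproveCore∣₁₉` ∕ `hImproveCoreFlat` (SU84 ∕ Luckhaus-class
lattice regularity — NOT in print), `hImprove`, K1-exp, `MeanDeviationL`, `BlockLipschitzL`, `HistoryTailL`, a continuum limit or a mass gap are NOT
proved.  YM₃ on T³ is rung R3, NOT the Clay problem.

References: R. Schoen, K. Uhlenbeck, Invent. Math. **78** (1984) 89–100 [SchoenUhlenbeck1984] §2; Y. L. Xin, Duke Math. J. **47** (1980) 609–613 [Xin1980];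
T. Bałaban, Commun. Math. Phys. **98** (1985) 17–51 [Balaban1985Averaging] §3 (lattice letters).
-/

set_option autoImplicit false

noncomputable section

open scoped BigOperators InnerProductSpace
open Finset Matrix WithLp

namespace Summit.QuantumFields.YangMills.Theorems.PoincareLipschitzImproveCoreOfCapped

open Literature.MathematicalPhysics.QuantumFieldTheory.Balaban1983to89.B4Eq19LatticeOperators
  (Zd unitVec box mem_box box_mono card_box add_unitVec_mem_box sub_unitVec_mem_box self_mem_box)
open Summit.QuantumFields.YangMills.Theorems.PoincareLipschitzLogCutoffStabilityCap (exists_scale_energy_le)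
open Summit.QuantumFields.YangMills.Theorems.PoincareLipschitzEuclideanTwistDictionary

/-! ## §2 The organ's local-minimality row feeds the Leung–Xin minimality; the box energy in coordinates -/

/-- ★★ **THE ORGAN'S LOCAL-MINIMALITY ROW FEEDS THE LEUNG–XIN MINIMALITY.**  If `u` (unit, `E⁴`-valued) minimises the twisted energy
`Σ_{y∈Q_R(z)}Σ_μ ‖τ_μ^y u(y+e_μ) − u(y)‖²` among unit fields agreeing with it off `Q_{R−1}(z)` (the FROZEN organ's row 5 at `(z, R−1)`), then for every
cutoff `η` supported in `Q_{2M}(z) ⊆ Q_{R−1}(z)`, every coordinate field `a` and every `t`, the twisted CORRELATION of the Leung–Xin varied map (read in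
coordinates, twists = the standard matrices of `τ_μ^y`) does not exceed that of `u` — ✓`exists_scale_energy_le`'s hypothesis on `T = Q_R(z) × Fin 3`.
[cite: Xin1980, p.609–613] -/
theorem sum_corr_varied_le_of_localMin (u : Zd 3 → EuclideanSpace ℝ (Fin 4)) (hu : ∀ y, ‖u y‖ = 1)
    (τ : Fin 3 → Zd 3 → (EuclideanSpace ℝ (Fin 4) ≃ₗᵢ[ℝ] EuclideanSpace ℝ (Fin 4))) (z : Zd 3) (R : ℤ) (hR : 1 ≤ R) (M : ℕ)
    (h2MR : 2 * (M : ℤ) ≤ R - 1)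
    (hloc : ∀ (z' : Zd 3) (R' : ℤ), 0 ≤ R' → box z' (R' + 1) ⊆ box z R →
      ∀ v : Zd 3 → EuclideanSpace ℝ (Fin 4), (∀ y, y ∉ box z' R' → v y = u y) → (∀ y ∈ box z' R', ‖v y‖ = 1) →
      ∑ y ∈ box z' (R' + 1), ∑ μ : Fin 3, ‖τ μ y (u (y + unitVec μ)) - u y‖ ^ 2 ≤
      ∑ y ∈ box z' (R' + 1), ∑ μ : Fin 3, ‖τ μ y (v (y + unitVec μ)) - v y‖ ^ 2)
    (η : Zd 3 → ℝ) (hηout : ∀ y ∉ box z (2 * (M : ℤ)), η y = 0) (a : Fin 4) (t : ℝ) :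
    ∑ y ∈ box z R, ∑ μ : Fin 3, dotProduct ((Real.sqrt (1 + t ^ 2 * dotProduct (η y • (Pi.single a 1 - dotProduct (Pi.single a 1) (ofLp (u y)) • ofLp (u y)))
        (η y • (Pi.single a 1 - dotProduct (Pi.single a 1) (ofLp (u y)) • ofLp (u y)))))⁻¹ •
      (ofLp (u y) + t • (η y • (Pi.single a 1 - dotProduct (Pi.single a 1) (ofLp (u y)) • ofLp (u y)))))
        (((Matrix.of fun i j => ofLp (τ μ y (EuclideanSpace.single j (1 : ℝ))) i)ᵀ)ᵀ *ᵥ ((Real.sqrt (1 + t ^ 2 * dotProduct (η (y + unitVec μ) • (Pi.single a 1 - dotProduct (Pi.single a 1) (ofLp (u (y + unitVec μ))) • ofLp (u (y + unitVec μ))))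
        (η (y + unitVec μ) • (Pi.single a 1 - dotProduct (Pi.single a 1) (ofLp (u (y + unitVec μ))) • ofLp (u (y + unitVec μ))))))⁻¹ •
      (ofLp (u (y + unitVec μ)) + t • (η (y + unitVec μ) • (Pi.single a 1 - dotProduct (Pi.single a 1) (ofLp (u (y + unitVec μ))) • ofLp (u (y + unitVec μ))))))) ≤
      ∑ y ∈ box z R, ∑ μ : Fin 3, dotProduct (ofLp (u y)) (((Matrix.of fun i j => ofLp (τ μ y (EuclideanSpace.single j (1 : ℝ))) i)ᵀ)ᵀ *ᵥ ofLp (u (y + unitVec μ))) := by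
  classical
  -- the competitor
  set v : Zd 3 → EuclideanSpace ℝ (Fin 4) := fun x => toLp 2 ((Real.sqrt (1 + t ^ 2 * dotProduct (η x • (Pi.single a 1 - dotProduct (Pi.single a 1) (ofLp (u x)) • ofLp (u x)))
        (η x • (Pi.single a 1 - dotProduct (Pi.single a 1) (ofLp (u x)) • ofLp (u x)))))⁻¹ •
      (ofLp (u x) + t • (η x • (Pi.single a 1 - dotProduct (Pi.single a 1) (ofLp (u x)) • ofLp (u x))))) with hv
  have hvx : ∀ x, ofLp (v x) = (Real.sqrt (1 + t ^ 2 * dotProduct (η x • (Pi.single a 1 - dotProduct (Pi.single a 1) (ofLp (u x)) • ofLp (u x)))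
        (η x • (Pi.single a 1 - dotProduct (Pi.single a 1) (ofLp (u x)) • ofLp (u x)))))⁻¹ •
      (ofLp (u x) + t • (η x • (Pi.single a 1 - dotProduct (Pi.single a 1) (ofLp (u x)) • ofLp (u x)))) := fun x => by
    simp only [hv, WithLp.ofLp_toLp]
  have hv1 : ∀ x, ‖v x‖ = 1 := fun x => norm_eq_one_of_ofLp_eq_varied u hu η a t x (v x) (hvx x)
  have hvout : ∀ y, y ∉ box z (R - 1) → v y = u y := by
    intro y hy
    have hy' : y ∉ box z (2 * (M : ℤ)) := fun h => hy (box_mono z h2MR h)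
    exact eq_of_ofLp_eq_varied_of_zero u a t (hηout y hy') (v y) (hvx y)
  have hrow := hloc z (R - 1) (by linarith) (by rw [sub_add_cancel]) v hvout (fun y _ => hv1 y)
  rw [sub_add_cancel] at hrow
  -- `‖τ w′ − w‖² = 2 − 2⟪w, τ w′⟫ = 2 − 2·(coordinates)`
  have hU : ∀ (y : Zd 3) (μ : Fin 3), ‖τ μ y (u (y + unitVec μ)) - u y‖ ^ 2 =
      2 - 2 * dotProduct (ofLp (u y)) (((Matrix.of fun i j => ofLp (τ μ y (EuclideanSpace.single j (1 : ℝ))) i)ᵀ)ᵀ *ᵥ ofLp (u (y + unitVec μ))) := by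
    intro y μ
    rw [norm_sub_sq_eq_two_sub (τ μ y) (hu y) (hu _), inner_map_eq_dot]
  have hV : ∀ (y : Zd 3) (μ : Fin 3), ‖τ μ y (v (y + unitVec μ)) - v y‖ ^ 2 =
      2 - 2 * dotProduct (ofLp (v y)) (((Matrix.of fun i j => ofLp (τ μ y (EuclideanSpace.single j (1 : ℝ))) i)ᵀ)ᵀ *ᵥ ofLp (v (y + unitVec μ))) := by
    intro y μ
    rw [norm_sub_sq_eq_two_sub (τ μ y) (hv1 y) (hv1 _), inner_map_eq_dot]
  simp only [hU, hV] at hrow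
  have hsplit : ∀ g : Zd 3 → Fin 3 → ℝ, ∑ y ∈ box z R, ∑ μ : Fin 3, (2 - 2 * g y μ) =
      ∑ y ∈ box z R, ∑ _μ : Fin 3, (2 : ℝ) - 2 * ∑ y ∈ box z R, ∑ μ : Fin 3, g y μ := by
    intro g
    rw [Finset.mul_sum, ← Finset.sum_sub_distrib]
    refine Finset.sum_congr rfl fun y _ => ?_
    rw [Finset.mul_sum, ← Finset.sum_sub_distrib]
  rw [hsplit (fun y μ => dotProduct (ofLp (u y)) (((Matrix.of fun i j => ofLp (τ μ y (EuclideanSpace.single j (1 : ℝ))) i)ᵀ)ᵀ *ᵥ ofLp (u (y + unitVec μ)))),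
    hsplit (fun y μ => dotProduct (ofLp (v y)) (((Matrix.of fun i j => ofLp (τ μ y (EuclideanSpace.single j (1 : ℝ))) i)ᵀ)ᵀ *ᵥ ofLp (v (y + unitVec μ))))] at hrow
  have h2 := (sub_le_sub_iff_left _).1 hrow
  have h3 := le_of_mul_le_mul_left h2 two_pos
  simp only [hvx] at h3
  exact h3

/-- The organ's twisted box energy in coordinates. [folklore] -/
theorem energy_box_eq_sum_dot (u : Zd 3 → EuclideanSpace ℝ (Fin 4))
    (τ : Fin 3 → Zd 3 → (EuclideanSpace ℝ (Fin 4) ≃ₗᵢ[ℝ] EuclideanSpace ℝ (Fin 4))) (z : Zd 3) (ρ : ℤ) :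
    ∑ y ∈ box z ρ, ∑ μ : Fin 3, ‖τ μ y (u (y + unitVec μ)) - u y‖ ^ 2 =
      ∑ b ∈ (box z ρ) ×ˢ (Finset.univ : Finset (Fin 3)),
        dotProduct (ofLp (u b.1) - ((Matrix.of fun i j => ofLp (τ b.2 b.1 (EuclideanSpace.single j (1 : ℝ))) i)ᵀ)ᵀ *ᵥ ofLp (u (b.1 + unitVec b.2)))
          (ofLp (u b.1) - ((Matrix.of fun i j => ofLp (τ b.2 b.1 (EuclideanSpace.single j (1 : ℝ))) i)ᵀ)ᵀ *ᵥ ofLp (u (b.1 + unitVec b.2))) := by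
  rw [Finset.sum_product]
  refine Finset.sum_congr rfl fun y _ => Finset.sum_congr rfl fun μ _ => ?_
  exact norm_sub_sq_eq_dot (τ μ y) (u y) (u (y + unitVec μ))

/-! ## §3 One good scale per window, in the organ's letters -/

/-- ★★ **ONE GOOD SCALE PER WINDOW, IN THE ORGAN'S LETTERS.**  For every `c > 18` there is `C₁ ≥ 1` such that: if `u : ℤ³ → S³ ⊂ E⁴` with twists
`τ μ y` of defect `≤ τ₀` on `Q_{R+1}(z)` is locally minimal among unit fields in every sub-box of `Q_R(z)` (the FROZEN organ's rows 1, 2, 5), and the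
scales `1 ≤ r`, `C₁r ≤ M`, `2M ≤ R − 1` carry the normalised twist smallness `3(2R+1)³·4τ₀² ≤ r`, then some `k ∈ [r, M)` has
`E_τ(Q_{k−1}(z)) ≤ c·k`.  (✓`exists_scale_energy_le` on `T = Q_R(z) × Fin 3` through §1–§2.) [cite: SchoenUhlenbeck1984, §2; Xin1980, p.609–613] -/
theorem exists_scale_energy_le_organ {c : ℝ} (hc : 18 < c) : ∃ C₁ : ℝ, 1 ≤ C₁ ∧
    ∀ (u : Zd 3 → EuclideanSpace ℝ (Fin 4)) (τ : Fin 3 → Zd 3 → (EuclideanSpace ℝ (Fin 4) ≃ₗᵢ[ℝ] EuclideanSpace ℝ (Fin 4)))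
      (z : Zd 3) (R : ℤ) (τ₀ : ℝ) (r M : ℕ),
      (∀ y, ‖u y‖ = 1) →
      (∀ y ∈ box z (R + 1), ∀ (μ : Fin 3) (w : EuclideanSpace ℝ (Fin 4)), ‖τ μ y w - w‖ ≤ τ₀ * ‖w‖) →
      (∀ (z' : Zd 3) (R' : ℤ), 0 ≤ R' → box z' (R' + 1) ⊆ box z R →
        ∀ v : Zd 3 → EuclideanSpace ℝ (Fin 4), (∀ y, y ∉ box z' R' → v y = u y) → (∀ y ∈ box z' R', ‖v y‖ = 1) →
        ∑ y ∈ box z' (R' + 1), ∑ μ : Fin 3, ‖τ μ y (u (y + unitVec μ)) - u y‖ ^ 2 ≤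
        ∑ y ∈ box z' (R' + 1), ∑ μ : Fin 3, ‖τ μ y (v (y + unitVec μ)) - v y‖ ^ 2) →
      1 ≤ R → 1 ≤ r → C₁ * r ≤ M → 2 * (M : ℤ) ≤ R - 1 →
      3 * ((2 * R + 1 : ℤ) : ℝ) ^ 3 * (4 * τ₀ ^ 2) ≤ r →
      ∃ k : ℕ, r ≤ k ∧ k < M ∧
        ∑ y ∈ box z ((k : ℤ) - 1), ∑ μ : Fin 3, ‖τ μ y (u (y + unitVec μ)) - u y‖ ^ 2 ≤ c * k := by
  classical
  obtain ⟨C₁, hC₁, hmainC⟩ := exists_scale_energy_le hc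
  refine ⟨C₁, hC₁, ?_⟩
  intro u τ z R τ₀ r M hu hdef hloc hR1 hr1 hM_ge h2MR hsmall
  have hMR : (M : ℤ) ≤ R := by linarith
  -- the data in `Fin 4 → ℝ` letters
  set T : Finset (Zd 3 × Fin 3) := (box z R) ×ˢ (Finset.univ : Finset (Fin 3)) with hT
  set S : Zd 3 × Fin 3 → Matrix (Fin 4) (Fin 4) ℝ :=
    fun b => (Matrix.of fun i j => ofLp (τ b.2 b.1 (EuclideanSpace.single j (1 : ℝ))) i)ᵀ with hS
  have hu' : ∀ x, dotProduct (ofLp (u x)) (ofLp (u x)) = 1 := fun x => dot_self_eq_one_of_norm (hu x)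
  have hSS : ∀ b ∈ T, S b * (S b)ᵀ = 1 := fun b _ => transpose_mul_self_eq_one (τ b.2 b.1)
  -- the normalised twist smallness
  have hF : ∑ b ∈ T.filter (fun b => b.1 ∈ box z (2 * (M : ℤ))),
      ∑ a : Fin 4, ∑ i : Fin 4, (S b a i - (1 : Matrix (Fin 4) (Fin 4) ℝ) a i) ^ 2 ≤ r := by
    have hper : ∀ b ∈ T.filter (fun b => b.1 ∈ box z (2 * (M : ℤ))),
        ∑ a : Fin 4, ∑ i : Fin 4, (S b a i - (1 : Matrix (Fin 4) (Fin 4) ℝ) a i) ^ 2 ≤ 4 * τ₀ ^ 2 := by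
      intro b hb
      rw [Finset.mem_filter, hT, Finset.mem_product] at hb
      have hy : b.1 ∈ box z (R + 1) := box_mono z (by linarith) hb.1.1
      exact frob_transpose_le (τ b.2 b.1) (fun w => hdef b.1 hy b.2 w)
    have hcard : ((T.filter (fun b => b.1 ∈ box z (2 * (M : ℤ)))).card : ℝ) ≤ 3 * ((2 * R + 1 : ℤ) : ℝ) ^ 3 := by
      have h1 : (T.filter (fun b => b.1 ∈ box z (2 * (M : ℤ)))).card ≤ T.card := Finset.card_filter_le _ _
      have h2 : T.card = (box z R).card * 3 := by
        rw [hT, Finset.card_product, Finset.card_univ, Fintype.card_fin]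
      have h3 : ((box z R).card : ℝ) = ((2 * R + 1 : ℤ) : ℝ) ^ 3 := card_box z (by linarith)
      have h1' : ((T.filter (fun b => b.1 ∈ box z (2 * (M : ℤ)))).card : ℝ) ≤ (T.card : ℝ) := by exact_mod_cast h1
      rw [h2] at h1'; push_cast at h1'; rw [h3] at h1'; linarith
    calc ∑ b ∈ T.filter (fun b => b.1 ∈ box z (2 * (M : ℤ))), ∑ a : Fin 4, ∑ i : Fin 4, (S b a i - (1 : Matrix (Fin 4) (Fin 4) ℝ) a i) ^ 2
        ≤ ∑ _b ∈ T.filter (fun b => b.1 ∈ box z (2 * (M : ℤ))), 4 * τ₀ ^ 2 := Finset.sum_le_sum hper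
      _ = ((T.filter (fun b => b.1 ∈ box z (2 * (M : ℤ)))).card : ℝ) * (4 * τ₀ ^ 2) := by rw [Finset.sum_const, nsmul_eq_mul]
      _ ≤ 3 * ((2 * R + 1 : ℤ) : ℝ) ^ 3 * (4 * τ₀ ^ 2) := mul_le_mul_of_nonneg_right hcard (by positivity)
      _ ≤ r := hsmall
  -- ★ the Leung–Xin minimality on `T`, from the organ's local-minimality row at `(z, R − 1)` (§2)
  have hminC : ∀ η : Zd 3 → ℝ, (∀ y ∉ box z (2 * (M : ℤ)), η y = 0) → (∀ y, 0 ≤ η y) → ∀ (a : Fin 4) (t : ℝ),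
      ∑ b ∈ T, dotProduct
        ((Real.sqrt (1 + t ^ 2 * dotProduct (η b.1 • (Pi.single a 1 - dotProduct (Pi.single a 1) (ofLp (u b.1)) • ofLp (u b.1)))
            (η b.1 • (Pi.single a 1 - dotProduct (Pi.single a 1) (ofLp (u b.1)) • ofLp (u b.1)))))⁻¹ •
          (ofLp (u b.1) + t • (η b.1 • (Pi.single a 1 - dotProduct (Pi.single a 1) (ofLp (u b.1)) • ofLp (u b.1)))))
        ((S b)ᵀ *ᵥ ((Real.sqrt (1 + t ^ 2 * dotProduct (η (b.1 + unitVec b.2) •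
              (Pi.single a 1 - dotProduct (Pi.single a 1) (ofLp (u (b.1 + unitVec b.2))) • ofLp (u (b.1 + unitVec b.2))))
            (η (b.1 + unitVec b.2) • (Pi.single a 1 - dotProduct (Pi.single a 1) (ofLp (u (b.1 + unitVec b.2))) • ofLp (u (b.1 + unitVec b.2))))))⁻¹ •
          (ofLp (u (b.1 + unitVec b.2)) + t • (η (b.1 + unitVec b.2) •
            (Pi.single a 1 - dotProduct (Pi.single a 1) (ofLp (u (b.1 + unitVec b.2))) • ofLp (u (b.1 + unitVec b.2))))))) ≤
      ∑ b ∈ T, dotProduct (ofLp (u b.1)) ((S b)ᵀ *ᵥ ofLp (u (b.1 + unitVec b.2))) := by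
    intro η hηout _hη0 a t
    rw [hT, Finset.sum_product, Finset.sum_product]
    exact sum_corr_varied_le_of_localMin u hu τ z R hR1 M h2MR hloc η hηout a t
  -- ★ one good scale in the window
  obtain ⟨k, hrk, hkM, hEk⟩ := hmainC T (fun y => ofLp (u y)) S z r M hu' hSS hr1 hM_ge hF hminC
  refine ⟨k, hrk, hkM, ?_⟩
  have hkR : (k : ℤ) ≤ R := le_trans (by exact_mod_cast hkM.le) hMR
  have h1 : ∑ y ∈ box z ((k : ℤ) - 1), ∑ μ : Fin 3, ‖τ μ y (u (y + unitVec μ)) - u y‖ ^ 2 =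
      ∑ b ∈ (box z ((k : ℤ) - 1)) ×ˢ (Finset.univ : Finset (Fin 3)),
        dotProduct (ofLp (u b.1) - (S b)ᵀ *ᵥ ofLp (u (b.1 + unitVec b.2))) (ofLp (u b.1) - (S b)ᵀ *ᵥ ofLp (u (b.1 + unitVec b.2))) :=
    energy_box_eq_sum_dot u τ z _
  have h2 : (box z ((k : ℤ) - 1)) ×ˢ (Finset.univ : Finset (Fin 3)) ⊆
      T.filter (fun b => b.1 ∈ box z (k : ℤ) ∧ b.1 + unitVec b.2 ∈ box z (k : ℤ)) := by
    intro b hb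
    rw [Finset.mem_product] at hb
    rw [Finset.mem_filter, hT, Finset.mem_product]
    have hb1 : b.1 ∈ box z (k : ℤ) := box_mono z (by linarith) hb.1
    refine ⟨⟨box_mono z hkR hb1, Finset.mem_univ _⟩, hb1, ?_⟩
    have := add_unitVec_mem_box hb.1 b.2
    rwa [sub_add_cancel] at this
  have he0 : ∀ b ∈ T.filter (fun b => b.1 ∈ box z (k : ℤ) ∧ b.1 + unitVec b.2 ∈ box z (k : ℤ)),
      b ∉ (box z ((k : ℤ) - 1)) ×ˢ (Finset.univ : Finset (Fin 3)) →
      0 ≤ dotProduct (ofLp (u b.1) - (S b)ᵀ *ᵥ ofLp (u (b.1 + unitVec b.2))) (ofLp (u b.1) - (S b)ᵀ *ᵥ ofLp (u (b.1 + unitVec b.2))) :=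
    fun b _ _ => by
      simp only [dotProduct, Pi.sub_apply]
      exact Finset.sum_nonneg fun i _ => mul_self_nonneg _
  rw [h1]
  exact le_trans (Finset.sum_le_sum_of_subset_of_nonneg h2 he0) hEk

/-! ## §4 ★★★ The organ's `∀Λ₀` is removable: `hImproveCore∣_{Λ₀ := c} ⟹ hImproveCore` for every `c > 18` -/

set_option maxHeartbeats 400000 in
/-- ★★★ **THE LARGE-ENERGY HALF OF THE K2 ORGAN IS FREE ON `ℤ³`.**  For every `c > 18`: the FROZEN organ `hImproveCore` v1 (LEAD ★w1-19936 g9,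
7446c95a; consumed by ✓K-4 `hImprove_of_core`, supplied from `hImproveCoreFlat` by ✓K-5 `hImproveCore_of_flat`) follows from its own instance at the SINGLE
energy level `Λ₀ := c` — hypothesis `hCap` = the organ text VERBATIM with the quantifier `∀ Λ₀` deleted and `Λ₀ * R` replaced by `c * R`.  Proof:
§3 at `c′ = (c+18)∕2` with `r = ⌊(R−5)∕(2C₁)⌋`, `M = ⌈C₁r⌉` (so `2M ≤ R − 1`, `R∕(4C₁) ≤ r`, and `3(2R+1)³·4τ₀² ≤ 324R(τ₀R)² ≤ 324R∕C₀² ≤ r` by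
`C₀ ≥ 1296C₁`) gives `k ∈ [r, M)` with `E_τ(Q_{k−1}) ≤ c′k ≤ c(k−1)` (`k ≥ 2c∕(c−18)`); the capped organ at the top scale `k − 1 ≥ R₀′` returns the good
scale `r′`, and `R ≤ (8C₁+10)C₀′·r′`.  So the K2 residue may be displayed PARAMETER-FREE (e.g. `c = 19`): «twisted local minimiser with `φ(R) ≤ 19` ⟹
`φ ≤ ε₁` at a comparable scale» — the gap ∕ compactness half of Schoen–Uhlenbeck only. [cite: SchoenUhlenbeck1984, §2; Xin1980, p.609–613] -/
theorem hImproveCore_of_capped {c : ℝ} (hc : 18 < c)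
    (hCap : ∀ (ε₁ : ℝ), 0 < ε₁ →
      ∃ (C₀ R₀ : ℝ), 1 ≤ C₀ ∧ 1 ≤ R₀ ∧
      ∀ (u : Zd 3 → EuclideanSpace ℝ (Fin 4)) (τ : Fin 3 → Zd 3 → (EuclideanSpace ℝ (Fin 4) ≃ₗᵢ[ℝ] EuclideanSpace ℝ (Fin 4)))
      (z : Zd 3) (R : ℤ) (τ₀ : ℝ),
      R₀ ≤ R →
      (∀ y, ‖u y‖ = 1) →
      (∀ y ∈ box z (R + 1), ∀ (μ : Fin 3) (w : EuclideanSpace ℝ (Fin 4)), ‖τ μ y w - w‖ ≤ τ₀ * ‖w‖) →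
      τ₀ * (R : ℝ) ≤ C₀⁻¹ →
      (∀ y ∈ box z R,
      ‖∑ μ : Fin 3, (τ μ y (u (y + unitVec μ)) + (τ μ (y - unitVec μ)).symm (u (y - unitVec μ)))‖ • u y =
      ∑ μ : Fin 3, (τ μ y (u (y + unitVec μ)) + (τ μ (y - unitVec μ)).symm (u (y - unitVec μ)))) →
      (∀ (z' : Zd 3) (R' : ℤ), 0 ≤ R' → box z' (R' + 1) ⊆ box z R →
      ∀ v : Zd 3 → EuclideanSpace ℝ (Fin 4), (∀ y, y ∉ box z' R' → v y = u y) → (∀ y ∈ box z' R', ‖v y‖ = 1) →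
      ∑ y ∈ box z' (R' + 1), ∑ μ : Fin 3, ‖τ μ y (u (y + unitVec μ)) - u y‖ ^ 2 ≤
      ∑ y ∈ box z' (R' + 1), ∑ μ : Fin 3, ‖τ μ y (v (y + unitVec μ)) - v y‖ ^ 2) →
      (∑ y ∈ box z R, ∑ μ : Fin 3, ‖τ μ y (u (y + unitVec μ)) - u y‖ ^ 2 ≤ c * R) →
      ∃ r : ℤ, 1 ≤ r ∧ (R : ℝ) ≤ C₀ * r ∧ 4 * r ≤ R ∧
      ∑ y ∈ box z (2 * r), ∑ μ : Fin 3, ‖τ μ y (u (y + unitVec μ)) - u y‖ ^ 2 ≤ ε₁ * r) :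
    ∀ (Λ₀ ε₁ : ℝ), 0 < Λ₀ → 0 < ε₁ →
      ∃ (C₀ R₀ : ℝ), 1 ≤ C₀ ∧ 1 ≤ R₀ ∧
      ∀ (u : Zd 3 → EuclideanSpace ℝ (Fin 4)) (τ : Fin 3 → Zd 3 → (EuclideanSpace ℝ (Fin 4) ≃ₗᵢ[ℝ] EuclideanSpace ℝ (Fin 4)))
      (z : Zd 3) (R : ℤ) (τ₀ : ℝ),
      R₀ ≤ R →
      (∀ y, ‖u y‖ = 1) →
      (∀ y ∈ box z (R + 1), ∀ (μ : Fin 3) (w : EuclideanSpace ℝ (Fin 4)), ‖τ μ y w - w‖ ≤ τ₀ * ‖w‖) →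
      τ₀ * (R : ℝ) ≤ C₀⁻¹ →
      (∀ y ∈ box z R,
      ‖∑ μ : Fin 3, (τ μ y (u (y + unitVec μ)) + (τ μ (y - unitVec μ)).symm (u (y - unitVec μ)))‖ • u y =
      ∑ μ : Fin 3, (τ μ y (u (y + unitVec μ)) + (τ μ (y - unitVec μ)).symm (u (y - unitVec μ)))) →
      (∀ (z' : Zd 3) (R' : ℤ), 0 ≤ R' → box z' (R' + 1) ⊆ box z R →
      ∀ v : Zd 3 → EuclideanSpace ℝ (Fin 4), (∀ y, y ∉ box z' R' → v y = u y) → (∀ y ∈ box z' R', ‖v y‖ = 1) →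
      ∑ y ∈ box z' (R' + 1), ∑ μ : Fin 3, ‖τ μ y (u (y + unitVec μ)) - u y‖ ^ 2 ≤
      ∑ y ∈ box z' (R' + 1), ∑ μ : Fin 3, ‖τ μ y (v (y + unitVec μ)) - v y‖ ^ 2) →
      (∑ y ∈ box z R, ∑ μ : Fin 3, ‖τ μ y (u (y + unitVec μ)) - u y‖ ^ 2 ≤ Λ₀ * R) →
      ∃ r : ℤ, 1 ≤ r ∧ (R : ℝ) ≤ C₀ * r ∧ 4 * r ≤ R ∧
      ∑ y ∈ box z (2 * r), ∑ μ : Fin 3, ‖τ μ y (u (y + unitVec μ)) - u y‖ ^ 2 ≤ ε₁ * r := by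
  classical
  intro Λ₀ ε₁ _hΛ₀ hε₁
  -- constants
  have hc' : 18 < (c + 18) / 2 := by linarith
  obtain ⟨C₁, hC₁, hscale⟩ := exists_scale_energy_le_organ hc'
  obtain ⟨C₀', R₀', hC₀', hR₀', hcap⟩ := hCap ε₁ hε₁
  have hc18 : 0 < c - 18 := by linarith
  have hC₁0 : 0 < C₁ := by linarith
  set k₀ : ℝ := R₀' + 2 + 2 * c / (c - 18) with hk₀
  have hq0 : 0 ≤ 2 * c / (c - 18) := by positivity
  have hk₀3 : 3 ≤ k₀ := by rw [hk₀]; linarith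
  have hmax0 : 0 ≤ max (1296 * C₁) ((8 * C₁ + 10) * C₀') := le_trans (by positivity) (le_max_left _ _)
  have hCk : 0 ≤ C₁ * k₀ := mul_nonneg hC₁0.le (by linarith)
  refine ⟨max (1296 * C₁) ((8 * C₁ + 10) * C₀') + C₀', 2 * C₁ * (k₀ + 2) + 10 + 4 * C₁ + 5, by linarith, ?_, ?_⟩
  · have : 2 * C₁ * (k₀ + 2) = 2 * (C₁ * k₀) + 4 * C₁ := by ring
    rw [this]; linarith
  intro u τ z R τ₀ hR hu hdef hτR hopt hloc _henergy
  set C₀ : ℝ := max (1296 * C₁) ((8 * C₁ + 10) * C₀') + C₀' with hC₀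
  have hC₀ge' : C₀' ≤ C₀ := by rw [hC₀]; linarith
  have hC₀ge1 : 1296 * C₁ ≤ C₀ := by rw [hC₀]; linarith [le_max_left (1296 * C₁) ((8 * C₁ + 10) * C₀')]
  have hC₀ge2 : (8 * C₁ + 10) * C₀' ≤ C₀ := by rw [hC₀]; linarith [le_max_right (1296 * C₁) ((8 * C₁ + 10) * C₀')]
  have hC₀pos : 0 < C₀ := by linarith
  have hR' : 2 * (C₁ * k₀) + 4 * C₁ + 10 + 4 * C₁ + 5 ≤ (R : ℝ) := by
    have : 2 * C₁ * (k₀ + 2) = 2 * (C₁ * k₀) + 4 * C₁ := by ring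
    rw [this] at hR; exact hR
  have hR10 : 10 + 4 * C₁ ≤ (R : ℝ) := by linarith
  have hR1 : (1 : ℝ) ≤ R := by linarith
  have hR1' : 1 ≤ R := by exact_mod_cast hR1
  -- `τ₀ ≥ 0`
  have hτ₀ : 0 ≤ τ₀ := by
    have hz : z ∈ box z (R + 1) := self_mem_box z (by linarith)
    have h := hdef z hz 0 (u z)
    rw [hu, mul_one] at h
    exact le_trans (norm_nonneg _) h
  -- the scales `r` and `M`
  set r : ℕ := ⌊((R : ℝ) - 5) / (2 * C₁)⌋₊ with hr_def
  set M : ℕ := ⌈C₁ * r⌉₊ with hM_def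
  have hx0 : 0 ≤ ((R : ℝ) - 5) / (2 * C₁) := div_nonneg (by linarith) (by positivity)
  have hr_le : (r : ℝ) * (2 * C₁) ≤ (R : ℝ) - 5 := (le_div_iff₀ (by positivity)).1 (Nat.floor_le hx0)
  have hr_gt : (R : ℝ) - 5 < ((r : ℝ) + 1) * (2 * C₁) := (div_lt_iff₀ (by positivity)).1 (Nat.lt_floor_add_one _)
  have hrk₀ : k₀ + 1 ≤ r := by
    by_contra h
    push Not at h
    have : ((r : ℝ) + 1) * (2 * C₁) < (k₀ + 2) * (2 * C₁) := mul_lt_mul_of_pos_right (by linarith) (by positivity)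
    have h' : (k₀ + 2) * (2 * C₁) = 2 * (C₁ * k₀) + 4 * C₁ := by ring
    linarith
  have hr1 : 1 ≤ r := by
    have : (1 : ℝ) ≤ r := by linarith
    exact_mod_cast this
  have hr0 : (0 : ℝ) < r := by exact_mod_cast hr1
  have hM_ge : C₁ * r ≤ M := Nat.le_ceil _
  have hM_lt : (M : ℝ) < C₁ * r + 1 := Nat.ceil_lt_add_one (by positivity)
  have h2MR : 2 * (M : ℤ) ≤ R - 1 := by
    have h1 : 2 * (M : ℝ) < R - 3 := by linarith
    have h3 : 2 * (M : ℤ) < R - 3 := by exact_mod_cast h1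
    linarith
  have hrR4 : (R : ℝ) ≤ r * (4 * C₁) := by nlinarith
  -- the normalised twist smallness `3(2R+1)³·4τ₀² ≤ 324R(τ₀R)² ≤ 324R∕C₀² ≤ R∕(4C₁) ≤ r`
  have hsmall : 3 * ((2 * R + 1 : ℤ) : ℝ) ^ 3 * (4 * τ₀ ^ 2) ≤ r := by
    have h1 : ((2 * R + 1 : ℤ) : ℝ) ≤ 3 * R := by push_cast; linarith
    have h1' : 0 ≤ ((2 * R + 1 : ℤ) : ℝ) := by push_cast; linarith
    have h2 : ((2 * R + 1 : ℤ) : ℝ) ^ 3 ≤ (3 * (R : ℝ)) ^ 3 := pow_le_pow_left₀ h1' h1 3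
    have h4 : (τ₀ * R) ^ 2 ≤ C₀⁻¹ ^ 2 := pow_le_pow_left₀ (by positivity) hτR 2
    have h6 : 3 * ((2 * R + 1 : ℤ) : ℝ) ^ 3 * (4 * τ₀ ^ 2) ≤ 324 * (R : ℝ) * (τ₀ * R) ^ 2 := by
      have : 3 * (3 * (R : ℝ)) ^ 3 * (4 * τ₀ ^ 2) = 324 * (R : ℝ) * (τ₀ * R) ^ 2 := by ring
      rw [← this]
      exact mul_le_mul_of_nonneg_right (mul_le_mul_of_nonneg_left h2 (by norm_num)) (by positivity)
    have h7 : 324 * (R : ℝ) * (τ₀ * R) ^ 2 ≤ 324 * (R : ℝ) * C₀⁻¹ ^ 2 := mul_le_mul_of_nonneg_left h4 (by positivity)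
    have h9 : C₀⁻¹ ^ 2 * (1296 * C₁) ≤ C₀⁻¹ ^ 2 * C₀ := mul_le_mul_of_nonneg_left hC₀ge1 (by positivity)
    have h10 : C₀⁻¹ ^ 2 * C₀ = C₀⁻¹ := by field_simp
    have h11 : C₀⁻¹ ≤ 1 := by rw [inv_le_one_iff₀]; right; linarith
    rw [h10] at h9
    have h12 : C₀⁻¹ ^ 2 * (1296 * C₁) ≤ 1 := h9.trans h11
    have h8 : 324 * (R : ℝ) * C₀⁻¹ ^ 2 * (4 * C₁) ≤ R := by
      calc 324 * (R : ℝ) * C₀⁻¹ ^ 2 * (4 * C₁) = (R : ℝ) * (C₀⁻¹ ^ 2 * (1296 * C₁)) := by ring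
        _ ≤ (R : ℝ) * 1 := mul_le_mul_of_nonneg_left h12 (by linarith)
        _ = R := mul_one _
    have h13 : 324 * (R : ℝ) * C₀⁻¹ ^ 2 * (4 * C₁) ≤ r * (4 * C₁) := h8.trans hrR4
    have h14 : 324 * (R : ℝ) * C₀⁻¹ ^ 2 ≤ r := le_of_mul_le_mul_right h13 (by positivity)
    linarith
  -- ★ one good scale (§3)
  obtain ⟨k, hrk, hkM, hEk⟩ := hscale u τ z R τ₀ r M hu hdef hloc hR1' hr1 hM_ge h2MR hsmall
  have hMR : (M : ℤ) ≤ R := by linarith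
  have hrk' : (r : ℝ) ≤ k := by exact_mod_cast hrk
  have hk3 : (3 : ℝ) ≤ k := by linarith
  have hkR₀ : R₀' ≤ ((k : ℤ) - 1 : ℤ) := by
    have h3 : (((k : ℤ) - 1 : ℤ) : ℝ) = (k : ℝ) - 1 := by push_cast; ring
    rw [h3, hk₀] at *; linarith
  have hkc : (c + 18) / 2 * (k : ℝ) ≤ c * ((k : ℝ) - 1) := by
    have h2 : 2 * c / (c - 18) ≤ (k : ℝ) := by rw [hk₀] at hrk₀; linarith
    rw [div_le_iff₀ hc18] at h2
    linarith
  have hkR : (k : ℤ) ≤ R := le_trans (by exact_mod_cast hkM.le) hMR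
  have hEorg : ∑ y ∈ box z ((k : ℤ) - 1), ∑ μ : Fin 3, ‖τ μ y (u (y + unitVec μ)) - u y‖ ^ 2 ≤ c * ((((k : ℤ) - 1 : ℤ) : ℝ)) := by
    have h3 : (((k : ℤ) - 1 : ℤ) : ℝ) = (k : ℝ) - 1 := by push_cast; ring
    rw [h3]
    exact hEk.trans hkc
  -- ★ the capped organ at the top scale `k − 1`
  have hk1R : (k : ℤ) - 1 + 1 ≤ R + 1 := by linarith
  obtain ⟨r', hr'1, hr'C, hr'4, hr'E⟩ := hcap u τ z ((k : ℤ) - 1) τ₀ hkR₀ hu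
    (fun y hy μ w => hdef y (box_mono z hk1R hy) μ w)
    (by
      have h1 : (((k : ℤ) - 1 : ℤ) : ℝ) ≤ R := by
        have : (k : ℤ) - 1 ≤ R := by linarith
        exact_mod_cast this
      calc τ₀ * (((k : ℤ) - 1 : ℤ) : ℝ) ≤ τ₀ * R := mul_le_mul_of_nonneg_left h1 hτ₀
        _ ≤ C₀⁻¹ := hτR
        _ ≤ C₀'⁻¹ := by rw [inv_le_inv₀ hC₀pos (by linarith)]; exact hC₀ge')
    (fun y hy => hopt y (box_mono z (by linarith) hy))
    (fun z' R' hR' hsub v hv hv1 => hloc z' R' hR' (hsub.trans (box_mono z (by linarith))) v hv hv1)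
    hEorg
  refine ⟨r', hr'1, ?_, le_trans hr'4 (by linarith), hr'E⟩
  -- `R ≤ C₀ r′`
  have h1 : (((k : ℤ) - 1 : ℤ) : ℝ) = (k : ℝ) - 1 := by push_cast; ring
  rw [h1] at hr'C
  have hr'1' : (1 : ℝ) ≤ r' := by exact_mod_cast hr'1
  have h2 : ((r : ℝ) + 1) * (2 * C₁) ≤ ((k : ℝ) + 1) * (2 * C₁) := mul_le_mul_of_nonneg_right (by linarith) (by positivity)
  have h3 : (R : ℝ) ≤ (6 * C₁ + 5) * ((k : ℝ) - 1) := by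
    have : ((k : ℝ) + 1) * (2 * C₁) ≤ 3 * ((k : ℝ) - 1) * (2 * C₁) := mul_le_mul_of_nonneg_right (by linarith) (by positivity)
    nlinarith
  have h4 : (6 * C₁ + 5) * ((k : ℝ) - 1) ≤ (6 * C₁ + 5) * (C₀' * r') := mul_le_mul_of_nonneg_left hr'C (by positivity)
  have h5 : (6 * C₁ + 5) * (C₀' * r') ≤ (8 * C₁ + 10) * C₀' * r' := by
    have : 0 ≤ C₀' * r' := by positivity
    nlinarith
  calc (R : ℝ) ≤ (8 * C₁ + 10) * C₀' * r' := by linarith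
    _ ≤ C₀ * r' := mul_le_mul_of_nonneg_right hC₀ge2 (by linarith)

end Summit.QuantumFields.YangMills.Theorems.PoincareLipschitzImproveCoreOfCapped

end
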